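import Summits.HodgeConjecture.HodgeCM.PerL34.ArchCompactK_1

/-! PORT of `HodgeCM/PerL34/ArchCompactK.lean` (HodgeCMPerL run 82) — part 2: continuation of `Summits.HodgeConjecture.HodgeCM.PerL34.ArchCompactK_1` (split at a top-level declaration boundary by port_pkg.py; scope re-opened below; declarations unchanged). -/

-- port_pkg: scope re-opened for this part (file-level context, then the namespace/section stack open at the cut)
set_option autoImplicit false
noncomputable section
open scoped Matrix ComplexOrder MatrixOrder
open NumberField NumberField.InfinitePlace Topology
namespace HodgeCM.PerL34.ArchCompactK
section PerL
open HodgeCM.PerL34.AdelicUnitaryFactorisation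
open Literature.AlgebraicGeometry.ShimuraVarieties (signatureMatrix)
variable {L : CMField} {ι₁ : L →+* ℂ} (V : HermSpace3 L ι₁)
/-- A Sylvester frame at the PLACE of `ι₁`: `Tᴴ · H^{w₁} · T = J₂ = diag(1,1,-1)` for `w₁ = mk ι₁` (the chosen
embedding of `w₁` is `ι₁` or its conjugate; in the second case conjugate the frame of `signature_ι₁` entrywise). -/
theorem _root_.HodgeCM.HermSpace3.exists_frame_place :
    ∃ T : GL (Fin 3) ℂ, (T : Matrix (Fin 3) (Fin 3) ℂ)ᴴ * V.Hm.map (InfinitePlace.mk ι₁).embedding *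
      (T : Matrix (Fin 3) (Fin 3) ℂ) = signatureMatrix 2 := by
  obtain ⟨T, hT⟩ := V.signature_ι₁
  rcases NumberField.InfinitePlace.embedding_mk_eq ι₁ with he | he
  · exact ⟨T, by rw [he]; exact hT⟩
  · refine ⟨Units.map (RingHom.mapMatrix (starRingEnd ℂ)).toMonoidHom T, ?_⟩
    have hH : V.Hm.map (InfinitePlace.mk ι₁).embedding = (V.Hm.map ι₁).map (starRingEnd ℂ) := by
      ext i j
      rw [he, Matrix.map_apply, Matrix.map_apply, Matrix.map_apply, NumberField.ComplexEmbedding.conjugate_coe_eq]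
    rw [hH]
    show ((T : Matrix (Fin 3) (Fin 3) ℂ).map (starRingEnd ℂ))ᴴ * (V.Hm.map ι₁).map (starRingEnd ℂ) *
        (T : Matrix (Fin 3) (Fin 3) ℂ).map (starRingEnd ℂ) = signatureMatrix 2
    rw [← Matrix.conjTranspose_map (starRingEnd ℂ) (fun _ => rfl), ← Matrix.map_mul, ← Matrix.map_mul, hT,
      signatureMatrix_map_conj]

/-- **The shape of `K_∞`.**  In a Sylvester frame `T` at the place of `ι₁`, `g ∈ K_∞` iff `T⁻¹ g_{w₁} T`
commutes with `J₂ = diag(1,1,-1)`, i.e. is block-diagonal `U(2) × U(1)` (PerL l. 677: `K_x ≅ U(2) × U(1)`);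
the components at the other places range over the full (compact, §1) `U(H^{w}) ≅ U(3)`. -/
theorem _root_.HodgeCM.HermSpace3.mem_archK_iff_commute {T : GL (Fin 3) ℂ}
    (hT : (T : Matrix (Fin 3) (Fin 3) ℂ)ᴴ * V.Hm.map (InfinitePlace.mk ι₁).embedding *
      (T : Matrix (Fin 3) (Fin 3) ℂ) = signatureMatrix 2) (g : Uinf L V.Hm) :
    g ∈ V.archK T ↔
      ((T⁻¹ : GL (Fin 3) ℂ) : Matrix (Fin 3) (Fin 3) ℂ) * loc L V.Hm g (InfinitePlace.mk ι₁) *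
          (T : Matrix (Fin 3) (Fin 3) ℂ) * signatureMatrix 2 =
        signatureMatrix 2 * (((T⁻¹ : GL (Fin 3) ℂ) : Matrix (Fin 3) (Fin 3) ℂ) *
          loc L V.Hm g (InfinitePlace.mk ι₁) * (T : Matrix (Fin 3) (Fin 3) ℂ)) := by
  rw [HermSpace3.mem_archK_iff, HodgeCM.PerL34.ArchCompactK.mem_frameSet_iff_commute hT (signatureMatrix_mul_self 2)]
  exact and_iff_right (HodgeCM.PerL34.ArchCompactK.loc_mem_hUnitarySet L V.Hm g _)

end PerL

end HodgeCM.PerL34.ArchCompactK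

end

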